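/-
COR-CM (cell pub-hodgecm2, stage 2 of the Hodge ladder) — count-neutral own lane FOREIGN-SURFACE, part 2 (seat
prover-pub-hodgecm2-p2, binder prover 2, gen 23).  Theorems only; no definition, no named fact, nothing asserted.  Composition BY
NAME of `CorCM/FacePeriodsForeignSurface.lean` (part 1, p302314) with b30's re-bracketing `SexticCMThreefold.exists_isProductOf_iso_biproduct`
and this seat's dihedral-triple files (`CorCM/DihedralReflexTriple*.lean`, gen 19); nothing of theirs is restated.  NOT an E term, NOT a
display of record, no BINDER-OWNERS row; `Interfaces.lean` (C1) and `Assembly/ModelChain*.lean` untouched.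

HONEST FRAMING (COORDINATOR RULING — HODGE FRAMING CORRECTION, 2026-08-21T11:55:35Z): `HC_CM` is NOT proved, here or anywhere in the
tree.  This file proves NO face period and NO case of the Hodge conjecture: it records WHICH face periods the degree-by-degree lane
(hodge-director/B01-SIZE.md §4 T1 / INT-2, «first new content: [F:ℚ] = 8») must produce to settle the smallest configuration of CM
abelian varieties whose Hodge conjecture no tree theorem and no held source decides — the dihedral surface triple of
`HOME/pub-hodgecm2-p2/RM08-GAP.md` (Ramón-Marí 2008 Prop. 2.18, gap located by `DihedralReflexTriple.exists_exceptional_two_biproduct`).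
-/
import Summits.HodgeConjecture.CorCM.FacePeriodsForeignSurface
import Summits.HodgeConjecture.CorCM.SexticCMThreefoldCurvePowersHodgeOfMarkman
import Summits.HodgeConjecture.CorCM.DihedralReflexTripleCMHodge
import Literature.NumberTheory.NumberFields.CMFieldCompositum
import HarnessLib

/-!
# Face periods of ONE Galois CM field settle every biproduct of CM abelian varieties with CM inside it — and the
# dihedral surface triple `S₁ × S₂ × S₁′` is settled by the face periods of ONE Galois OCTIC CM field

Part 1 (`CorCM/FacePeriodsForeignSurface.lean`) closed the field-local schema with foreign surfaces: for ONE Galois CM field `L` with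
`6 ≤ [L:ℚ]`, one non-zero period per rank-four face of `L` — on a compact Picard modular surface of ANY CM field, at ANY place —
gives `HodgeConjectureFor` for every complex abelian variety dominated by a product tree (`AbelianVariety.IsProductOf`) of
realisations of CM types of CM fields embeddable in `L`.  Here:

* §1 **biproduct form** (`hodgeConjectureFor_of_avDominatedBy_biproduct_of_exists_foreignFacePeriod_at`): the same for the tree's
  indexed biproducts `⨁_{j : Fin (n+1)} A_j`, `A_j ⊨ (K_j; Φ_j)`, `K_j →+* L` — the shape in which this cell's census files state their
  products (`⨁ A`); no Galois, degree or simplicity hypothesis on the `K_j`, multiplicities free.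
* §2 **the dihedral surface triple.**  `K = K 0` a NON-Galois quartic CM field, `M = K 1` a quartic CM field all of whose complex
  embeddings land in the Galois closure `L₀ = normalClosure ℚ K ℂ` of `K` (the reflex class), `K 2 ≃ K`; `A_j ⊨ (K_j; Φ_j)` three
  CM abelian surfaces — for pairwise non-isogenous simple ones, `⨁ A = S₁ × S₂ × S₁′` carries a rational `(2,2)`-class outside
  `D² ⊗ ℂ` (`DihedralReflexTriple.exists_exceptional_two_biproduct_of_isSimple`, p261495), its algebraicity decided by no tree theorem
  (dimension `6 > 5`: beyond Moonen–Zarhin and the tree's `…dim_le_five_of_markman`; no imaginary quadratic field acts: not of Weil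
  type) and by no held source (Abdulali's 2016 list of known CM cases, *Recent Advances in Hodge Theory* App. A (3): powers of ONE CM
  surface, products of ≤ 3 CM elliptic curves, Tankeev's `2^d` closures — products of DIFFERENT CM surfaces absent).  THEOREMS:
  `exists_cmField_galois_eight` — `L₀` packaged as a term `L : CMField`, Galois over `ℚ` of degree `8` (dihedral), receiving `K 0`,
  `K 1`, `K 2` (Shimura 1998 §18.2 Lemma (iii): the Galois closure of a CM field is CM; `[L₀:ℚ] = 8`,
  `QuarticCMTypes.finrank_normalClosure_eq_eight_of_not_isGalois`); and
  **`hodgeConjectureFor_of_avDominatedBy_triple_of_forall_galois_octic_foreignFacePeriods`** — if every Galois CM field `L` of degree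
  `8` receiving `K 0` and `K 1` has, for each of its rank-four faces, ONE non-zero period on a compact Picard modular surface of SOME
  CM field at SOME place (the foreign witness of part 1), then the Hodge conjecture holds for `S₁ × S₂ × S₁′` and for every complex
  abelian variety it dominates — in every codimension.  So the first rung of the degree-by-degree lane beyond Markman's theorem
  (degree `8`, here with dihedral Galois group) is exactly what the Ramón-Marí configuration needs; ONE octic field per triple.

Nothing here asserts any period or any case of the Hodge conjecture.

## References
* [RamonMari2008] J. J. Ramón-Marí, *On the Hodge conjecture for products of certain surfaces*, Collect. Math. 59 (2008), Prop. 2.18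
  (the claim whose Goursat step fails at this triple; `RM08-GAP.md`).
* [Abdulali2016TateTwists] S. Abdulali, *Tate twists of Hodge structures arising from abelian varieties*, in *Recent Advances in Hodge Theory* (CUP 2016), Appendix A (known cases; held `book:kerr2016…` p. 298–300).
* [Shimura1998] G. Shimura, *Abelian Varieties with Complex Multiplication and Modular Functions* (1998), §6.2 Thm 3, §8.4 (2)(C), §18.2.
* [MoonenZarhin1999LowDim] B. Moonen, Yu. Zarhin, Math. Ann. 315 (1999) (dimension ≤ 5).
* [Pohlmann1968] H. Pohlmann, Ann. of Math. 88 (1968), Thm. 1.  [Andre1992HodgeCM] Y. André, Progr. Math. 102 (1992), pp. 4–5.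
* [MumfordAV1970] D. Mumford, *Abelian Varieties* (1970), §19 Thm. 1 and p. 169.
-/

noncomputable section

open CategoryTheory CategoryTheory.Limits NumberField
open Literature.AlgebraicGeometry Literature.AlgebraicGeometry.Motives Literature.AlgebraicGeometry.HodgeTheory
open Literature.AlgebraicGeometry.ComplexMultiplication Literature.AlgebraicGeometry.Milne1999
open Literature.NumberTheory.Automorphic
open Literature.NumberTheory.Automorphic.PicardCM
open Summit.HodgeConjecture.CorCM.Domination

namespace Summit.HodgeConjecture.CorCM

/-! ## §1 Biproducts of CM abelian varieties with CM fields inside ONE Galois CM field -/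

section Biproduct

variable {n : ℕ} {K : Fin (n + 1) → Type} [∀ j, Field (K j)] [∀ j, NumberField (K j)] [∀ j, IsCMField (K j)]
  {Φ : ∀ j, CMType (K j)} {A : Fin (n + 1) → AbelianVariety ℂ} {ι : ∀ j, 𝓞 (K j) →+* End (A j)}
  {θ : ∀ j, K j →+* Module.End ℂ (complexBetti (A j).X 1)}

/-- **INT-2 with foreign surfaces, biproduct form.**  `L` ONE Galois CM field with `6 ≤ [L:ℚ]`; `A_j ⊨ (K_j; Φ_j)` finitely many CM
abelian varieties whose CM fields embed in `L` (`emb j : K_j →+* L`; no Galois, degree or simplicity hypothesis on the `K_j`,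
repetitions free).  If every rank-four face of `L` has ONE non-zero period on a compact Picard modular surface of SOME CM field at SOME
place (the foreign witness of `hc_cm_closed_of_exists_foreignFacePeriod`), then every complex abelian variety `B` dominated by
`⨁_j A_j` satisfies the Hodge conjecture in every codimension.  (Re-bracket `⨁ A` as a product tree,
`SexticCMThreefold.exists_isProductOf_iso_biproduct`, then part 1's
`hodgeConjectureFor_of_avDominatedBy_isProductOf_of_exists_foreignFacePeriod_at`.)
[cite: Shimura1998, §6.2 Theorem 3 and §6.1 Corollary of Theorem 2 (pp. 41–43)] [cite: Pohlmann1968, Thm. 1]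
[cite: Andre1992HodgeCM, Théorème (pp. 4–5)] [cite: MumfordAV1970, §19 Thm. 1 and p. 169] -/
theorem hodgeConjectureFor_of_avDominatedBy_biproduct_of_exists_foreignFacePeriod_at (L : CMField) [IsGalois ℚ L]
    (h6 : 6 ≤ Module.finrank ℚ L)
    (h : ∀ f : Face L, ∃ (L' : CMField) (ι₁ : L' →+* ℂ) (V : HermSpace3 L' ι₁) (σ : L →+* ℂ),
      (Model.picardCMUniverse exists_isReal_hodgeModel_holds hodgePQ_independent_of_hodgeModel_holds
        BallQuotient.ballQuotientUniformised_holds cmAbelianVarietyRealised_holds).PeriodNV ι₁ V L f.psi σ)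
    (emb : ∀ j, K j →+* (L : Type)) (hA : ∀ j, IsCMTypeRealisation (Φ j) (A j) (ι j) (θ j))
    {B : AbelianVariety ℂ} (hB : AVDominatedBy B (⨁ A)) : HodgeConjectureFor B.dim B.X := by
  obtain ⟨P, hP, ⟨e⟩⟩ := SexticCMThreefold.exists_isProductOf_iso_biproduct
    (Q := fun B : AbelianVariety ℂ =>
      ∃ (E : Type) (_ : Field E) (_ : NumberField E) (_ : IsCMField E) (_ : E →+* (L : Type)) (Φ : CMType E)
        (ι : 𝓞 E →+* End B) (θ : E →+* Module.End ℂ (complexBetti B.X 1)), IsCMTypeRealisation Φ B ι θ)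
    n A fun j => ⟨K j, inferInstance, inferInstance, inferInstance, emb j, Φ j, ι j, θ j, hA j⟩
  exact hodgeConjectureFor_of_avDominatedBy_isProductOf_of_exists_foreignFacePeriod_at L h6 h hP (hB.of_iso_right e)

/-- The biproduct `⨁_j A_j` itself. [cite: Pohlmann1968, Thm. 1] [cite: Andre1992HodgeCM, Théorème (pp. 4–5)] -/
theorem hodgeConjectureFor_biproduct_of_exists_foreignFacePeriod_at (L : CMField) [IsGalois ℚ L]
    (h6 : 6 ≤ Module.finrank ℚ L)
    (h : ∀ f : Face L, ∃ (L' : CMField) (ι₁ : L' →+* ℂ) (V : HermSpace3 L' ι₁) (σ : L →+* ℂ),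
      (Model.picardCMUniverse exists_isReal_hodgeModel_holds hodgePQ_independent_of_hodgeModel_holds
        BallQuotient.ballQuotientUniformised_holds cmAbelianVarietyRealised_holds).PeriodNV ι₁ V L f.psi σ)
    (emb : ∀ j, K j →+* (L : Type)) (hA : ∀ j, IsCMTypeRealisation (Φ j) (A j) (ι j) (θ j)) :
    HodgeConjectureFor (⨁ A).dim (⨁ A).X :=
  hodgeConjectureFor_of_avDominatedBy_biproduct_of_exists_foreignFacePeriod_at L h6 h emb hA (AVDominatedBy.refl _)

/-- The same-field / admissible-place witnesses of b07's `hc_cm_closed_of_exists_facePeriod` (and a fortiori `PerLFace` of the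
universe of record restricted to `L`) suffice as well (they are foreign witnesses with `L' := L`). [folklore] -/
theorem hodgeConjectureFor_of_avDominatedBy_biproduct_of_exists_facePeriod_at (L : CMField) [IsGalois ℚ L]
    (h6 : 6 ≤ Module.finrank ℚ L)
    (h : ∀ f : Face L, ∃ ι₁ : (L : Type) →+* ℂ, f.Admissible ι₁ ∧ ∃ (V : HermSpace3 L ι₁) (σ : L →+* ℂ),
      (Model.picardCMUniverse exists_isReal_hodgeModel_holds hodgePQ_independent_of_hodgeModel_holds
        BallQuotient.ballQuotientUniformised_holds cmAbelianVarietyRealised_holds).PeriodNV ι₁ V L f.psi σ)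
    (emb : ∀ j, K j →+* (L : Type)) (hA : ∀ j, IsCMTypeRealisation (Φ j) (A j) (ι j) (θ j))
    {B : AbelianVariety ℂ} (hB : AVDominatedBy B (⨁ A)) : HodgeConjectureFor B.dim B.X :=
  hodgeConjectureFor_of_avDominatedBy_biproduct_of_exists_foreignFacePeriod_at L h6
    (fun f => Universe.exists_foreignPeriodNV_of_exists_periodNV f (h f)) emb hA hB

end Biproduct

/-! ## §2 The dihedral surface triple `S₁ × S₂ × S₁′` (Ramón-Marí's configuration) -/

namespace DihedralReflexTriple

open IntermediateField

variable {K : Fin 3 → Type} [∀ j, Field (K j)] [∀ j, NumberField (K j)] [∀ j, IsCMField (K j)]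
  {Φ : ∀ j, CMType (K j)} {A : Fin 3 → AbelianVariety ℂ} {ι : ∀ j, 𝓞 (K j) →+* End (A j)}
  {θ : ∀ j, K j →+* Module.End ℂ (complexBetti (A j).X 1)}

/-- **The common Galois closure, as a term of `CMField`.**  For a NON-Galois quartic CM field `K 0`, a field `K 1` all of whose complex
embeddings land in `normalClosure ℚ (K 0) ℂ` (the reflex class) and `K 2 ≃ K 0`: there is a Galois CM field `L` of degree `8` receiving
`K 0`, `K 1` and `K 2` — the Galois closure itself (CM by Shimura 1998 §18.2 Lemma (iii), tree `isCMField_normalClosure`; Galois,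
`isGalois_normalClosure_complex`; degree `8`, `QuarticCMTypes.finrank_normalClosure_eq_eight_of_not_isGalois`).
[cite: Shimura1998, §18.2 Lemma (iii) and §8.4 Example (2)(C)] -/
theorem exists_cmField_galois_eight (h4₀ : Module.finrank ℚ (K 0) = 4) (hK₀ : ¬IsGalois ℚ (K 0))
    (hMK : ∀ (t : K 1 →+* ℂ) (y : K 1), t y ∈ normalClosure ℚ (K 0) ℂ) (e : K 2 ≃+* K 0) :
    ∃ (L : CMField) (_ : IsGalois ℚ L), Module.finrank ℚ L = 8 ∧
      Nonempty (K 0 →+* (L : Type)) ∧ Nonempty (K 1 →+* (L : Type)) ∧ Nonempty (K 2 →+* (L : Type)) := by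
  haveI : NumberField ↥(normalClosure ℚ (K 0) ℂ) :=
    { to_charZero := inferInstance, to_finiteDimensional := inferInstance }
  haveI : IsCMField ↥(normalClosure ℚ (K 0) ℂ) :=
    Literature.NumberTheory.NumberFields.isCMField_normalClosure (K 0)
  haveI hG : IsGalois ℚ ↥(normalClosure ℚ (K 0) ℂ) :=
    Literature.NumberTheory.NumberFields.isGalois_normalClosure_complex (K 0)
  let φ : K 0 →ₐ[ℚ] ℂ := (Classical.arbitrary (K 0 →+* ℂ)).toRatAlgHom
  have e₀ : K 0 →+* ↥(normalClosure ℚ (K 0) ℂ) :=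
    (φ.codRestrict (normalClosure ℚ (K 0) ℂ).toSubalgebra fun x => φ.fieldRange_le_normalClosure ⟨x, rfl⟩).toRingHom
  have t₁ : K 1 →+* ℂ := Classical.arbitrary _
  have e₁ : K 1 →+* ↥(normalClosure ℚ (K 0) ℂ) := t₁.codRestrict (normalClosure ℚ (K 0) ℂ) (hMK t₁)
  exact ⟨⟨↥(normalClosure ℚ (K 0) ℂ)⟩, hG, DihedralReflexPair.finrank_normalClosure_eq_eight h4₀ hK₀, ⟨e₀⟩, ⟨e₁⟩,
    ⟨e₀.comp e.toRingHom⟩⟩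

/-- **The dihedral triple over a receiving Galois CM field.**  `A_j ⊨ (K_j; Φ_j)` for `j < 3`, the three CM fields embedded in ONE
Galois CM field `L` with `6 ≤ [L:ℚ]`: foreign face-period witnesses for the faces of `L` give the Hodge conjecture for every complex
abelian variety dominated by `⨁ A = A₀ × A₁ × A₂` (§1 at `n = 2`).  No simplicity, no non-isogeny hypothesis.
[cite: Pohlmann1968, Thm. 1] [cite: Andre1992HodgeCM, Théorème (pp. 4–5)] [cite: MumfordAV1970, §19 Thm. 1 and p. 169] -/
theorem hodgeConjectureFor_of_avDominatedBy_triple_of_exists_foreignFacePeriod_at (L : CMField) [IsGalois ℚ L]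
    (h6 : 6 ≤ Module.finrank ℚ L)
    (h : ∀ f : Face L, ∃ (L' : CMField) (ι₁ : L' →+* ℂ) (V : HermSpace3 L' ι₁) (σ : L →+* ℂ),
      (Model.picardCMUniverse exists_isReal_hodgeModel_holds hodgePQ_independent_of_hodgeModel_holds
        BallQuotient.ballQuotientUniformised_holds cmAbelianVarietyRealised_holds).PeriodNV ι₁ V L f.psi σ)
    (j₀ : K 0 →+* (L : Type)) (j₁ : K 1 →+* (L : Type)) (j₂ : K 2 →+* (L : Type))
    (hA : ∀ j, IsCMTypeRealisation (Φ j) (A j) (ι j) (θ j))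
    {B : AbelianVariety ℂ} (hB : AVDominatedBy B (⨁ A)) : HodgeConjectureFor B.dim B.X :=
  hodgeConjectureFor_of_avDominatedBy_biproduct_of_exists_foreignFacePeriod_at L h6 h
    (fun j => by
      match j with
      | 0 => exact j₀
      | 1 => exact j₁
      | 2 => exact j₂)
    hA hB

/-- **The Ramón-Marí configuration is settled by the face periods of ONE Galois OCTIC CM field.**  `K 0` a non-Galois quartic CM
field, `K 1` a CM field whose complex embeddings land in the Galois closure of `K 0`, `K 2 ≃ K 0`, and `A_j ⊨ (K_j; Φ_j)` three CM
abelian varieties — e.g. the three pairwise non-isogenous simple CM surfaces `S₁, S₂, S₁′` of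
`exists_exceptional_two_biproduct_of_isSimple`, whose product carries an exceptional rational `(2,2)`-class.  If EVERY Galois CM
field `L` of degree `8` receiving `K 0` and `K 1` has, for each rank-four face `f` of `L`, ONE non-zero period of the face quadruple
`f.psi` on a compact Picard modular surface of SOME CM field at SOME place (eigenforms at some `σ : L →+* ℂ`, some level) on the
universe of record, then the Hodge conjecture holds for `⨁ A = S₁ × S₂ × S₁′` and for every complex abelian variety it dominates, in
every codimension.  (By `exists_cmField_galois_eight` the hypothesis is about ONE field: the dihedral closure.)  FRAMING: conditional;
no period and no case of the Hodge conjecture is proved here.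
[cite: Shimura1998, §18.2 Lemma (iii) and §6.2 Theorem 3] [cite: Pohlmann1968, Thm. 1] [cite: Andre1992HodgeCM, Théorème (pp. 4–5)]
[cite: MumfordAV1970, §19 Thm. 1 and p. 169] -/
theorem hodgeConjectureFor_of_avDominatedBy_triple_of_forall_galois_octic_foreignFacePeriods
    (h4₀ : Module.finrank ℚ (K 0) = 4) (hK₀ : ¬IsGalois ℚ (K 0))
    (hMK : ∀ (t : K 1 →+* ℂ) (y : K 1), t y ∈ normalClosure ℚ (K 0) ℂ) (e : K 2 ≃+* K 0)
    (hA : ∀ j, IsCMTypeRealisation (Φ j) (A j) (ι j) (θ j))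
    (h : ∀ (L : CMField) [IsGalois ℚ L], Module.finrank ℚ L = 8 → Nonempty (K 0 →+* (L : Type)) →
      Nonempty (K 1 →+* (L : Type)) →
      ∀ f : Face L, ∃ (L' : CMField) (ι₁ : L' →+* ℂ) (V : HermSpace3 L' ι₁) (σ : L →+* ℂ),
        (Model.picardCMUniverse exists_isReal_hodgeModel_holds hodgePQ_independent_of_hodgeModel_holds
          BallQuotient.ballQuotientUniformised_holds cmAbelianVarietyRealised_holds).PeriodNV ι₁ V L f.psi σ)
    {B : AbelianVariety ℂ} (hB : AVDominatedBy B (⨁ A)) : HodgeConjectureFor B.dim B.X := by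
  obtain ⟨L, hG, h8, ⟨j₀⟩, ⟨j₁⟩, ⟨j₂⟩⟩ := exists_cmField_galois_eight h4₀ hK₀ hMK e
  exact hodgeConjectureFor_of_avDominatedBy_triple_of_exists_foreignFacePeriod_at L (by omega) (h L h8 ⟨j₀⟩ ⟨j₁⟩)
    j₀ j₁ j₂ hA hB

/-- The triple `S₁ × S₂ × S₁′` itself, under the same hypothesis. [cite: Pohlmann1968, Thm. 1] [cite: Andre1992HodgeCM, Théorème (pp. 4–5)] -/
theorem hodgeConjectureFor_triple_of_forall_galois_octic_foreignFacePeriods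
    (h4₀ : Module.finrank ℚ (K 0) = 4) (hK₀ : ¬IsGalois ℚ (K 0))
    (hMK : ∀ (t : K 1 →+* ℂ) (y : K 1), t y ∈ normalClosure ℚ (K 0) ℂ) (e : K 2 ≃+* K 0)
    (hA : ∀ j, IsCMTypeRealisation (Φ j) (A j) (ι j) (θ j))
    (h : ∀ (L : CMField) [IsGalois ℚ L], Module.finrank ℚ L = 8 → Nonempty (K 0 →+* (L : Type)) →
      Nonempty (K 1 →+* (L : Type)) →
      ∀ f : Face L, ∃ (L' : CMField) (ι₁ : L' →+* ℂ) (V : HermSpace3 L' ι₁) (σ : L →+* ℂ),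
        (Model.picardCMUniverse exists_isReal_hodgeModel_holds hodgePQ_independent_of_hodgeModel_holds
          BallQuotient.ballQuotientUniformised_holds cmAbelianVarietyRealised_holds).PeriodNV ι₁ V L f.psi σ) :
    HodgeConjectureFor (⨁ A).dim (⨁ A).X :=
  hodgeConjectureFor_of_avDominatedBy_triple_of_forall_galois_octic_foreignFacePeriods h4₀ hK₀ hMK e hA h
    (AVDominatedBy.refl _)

end DihedralReflexTriple

end Summit.HodgeConjecture.CorCM
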